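import Literature.NumberTheory.Transcendental.KZLogCalculusProofs
import Literature.NumberTheory.Transcendental.BoxIntegralZetaValues
import Literature.NumberTheory.Transcendental.KZMellinFibres

/-!
# `NormalFormPrinciple` (stmt-KontsevichZagierPeriods-3869), line `SketchIdeator1` —
# the level-one box tower: the band representations produced by the merge gadget exist

Pure proof file (stub `exists_bandRep_dim` of the level-one box tower, lead seat c7; `--supports`
the crux). In the tower `[(0,1)^{w+2}, c·xᵉ/(1 − x₀⋯x_{w+1})]` the merge gadget (rule (2) of the
Kontsevich–Zagier calculus) substitutes `z_{w+1} = y_a · x_{w+1}` along the last coordinate, `y_a`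
being the second-to-last coordinate (exponents `a > b` on the last two coordinates, `w` spectator
coordinates `Fin.init (Fin.init z)` with exponents `e`). It lands on the BAND
`T = {z : ℝ^{w+2} | init z ∈ (0,1)^{w+1}, 0 ≤ z_{w+1} ≤ z_w}` (a `KZlog.band` over the open unit box
of `ℝ^{w+1}`) with the integrand
`g z = c · (∏ spectatorsᵉ) · y_a^{a−b−1} · z_{w+1}^b / (1 − (∏ spectators) · z_{w+1})`.
We show that `[T, g]` is an integral representation (`KZ.IntegralRep (w + 2)`):

* `T` is `ℚ`-semialgebraic (`KZlog.isSemialgebraic_band` over `KZ.isSemialgebraic_box`);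
* `g` is a quotient of `ℚ`-polynomials whose denominator is positive on `T`, because the
  spectators lie in `(0,1)` and `(∏ spectators) · z_{w+1} ≤ z_{w+1} ≤ y_a < 1`
  (`isSemialgebraicFunOn_aeval_div_aeval`);
* absolute convergence (the content): by the change of variables
  `Φ x = (init x, y_a · x_{w+1})` (Jacobian determinant `y_a`, `LinearMap.det_of_snoc_init`;
  injective on `y_a > 0`; `MeasureTheory.integrableOn_image_iff_integrableOn_abs_det_fderiv_smul`)
  from the band-box `B₀ = (0,1)^{w+1} × [0,1]`, whose image contains `T`, integrability of `g` on
  `T` follows from that of `y_a · g (Φ x) = c · (∏ spectatorsᵉ) · y_a^{a−b} (y_a x_{w+1})^b /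
  (1 − x₀⋯x_{w+1})` on `B₀`; this is dominated by `|c|/(1 − x₀⋯x_{w+1})`, which is integrable on
  the open box `(0,1)^{w+2}` (the `ζ(w+2)` box integral,
  `BoxIntegral.integrableOn_box_one_div_one_sub_prod`), and `B₀` exceeds the open box by the two
  null faces `x_{w+1} ∈ {0, 1}`.

This is the dimension-`w + 2` analogue of the landed dimension-two file
`HurwitzMicroSectorsNormalFormPrincipleLevelOneExistsTriangleRep` (the triangle `w = 0`).
Sources: M. Kontsevich, D. Zagier, *Periods* (2001), §1.1–1.2; F. Beukers, *A note on the
irrationality of ζ(2) and ζ(3)*, Bull. LMS 11 (1979). No definitions are introduced.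
-/

noncomputable section

open MeasureTheory Set
open Literature.NumberTheory.Transcendental Literature.NumberTheory.Transcendental.KZ
open Literature.ModelTheory.ExponentialFields (IsSemialgebraic)

namespace Summit.KontsevichZagierPeriods.HurwitzMicroSectors.NormalFormPrinciple.PiBox.LevelOne

/-! ## The band and its integrand -/

/-- The band `T = {z | init z ∈ (0,1)^{w+1}, 0 ≤ z_{w+1} ≤ z_w}` over the open unit box of
`ℝ^{w+1}` is `ℚ`-semialgebraic: a band with semialgebraic base and edges.
[Kontsevich–Zagier 2001, §1.1] [folklore] -/
theorem isSemialgebraic_bandDim (w : ℕ) :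
    IsSemialgebraic ℚ (KZlog.band {y : Fin (w + 1) → ℝ | ∀ i, y i ∈ Set.Ioo (0:ℝ) 1}
      (fun _ => (0:ℝ)) (fun y => y (Fin.last w))) :=
  KZlog.isSemialgebraic_band
    (by simpa using isSemialgebraicFunOn_ratCast (isSemialgebraic_box (w + 1)) 0)
    (isSemialgebraicFunOn_apply (isSemialgebraic_box (w + 1)) (Fin.last w))

/-- On the band `T` the kernel denominator `1 − (∏ spectators) · z_{w+1}` is positive: the
spectators lie in `(0,1)` and `z_{w+1} ≤ z_w < 1`. [folklore] -/
theorem one_sub_prod_mul_pos_of_mem_bandDim {w : ℕ} {z : Fin (w + 2) → ℝ}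
    (hz : z ∈ KZlog.band {y : Fin (w + 1) → ℝ | ∀ i, y i ∈ Set.Ioo (0:ℝ) 1} (fun _ => (0:ℝ))
      (fun y => y (Fin.last w))) :
    0 < 1 - (∏ i, Fin.init (Fin.init z) i) * z (Fin.last (w + 1)) := by
  obtain ⟨hG, h0, h1⟩ := hz
  have hya : z (Fin.castSucc (Fin.last w)) < 1 := (hG (Fin.last w)).2
  have h0' : 0 ≤ z (Fin.last (w + 1)) := h0
  have h1' : z (Fin.last (w + 1)) ≤ z (Fin.castSucc (Fin.last w)) := h1
  have hP : ∏ i, Fin.init (Fin.init z) i ≤ 1 :=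
    Finset.prod_le_one (fun i _ => (hG (Fin.castSucc i)).1.le) fun i _ => (hG (Fin.castSucc i)).2.le
  exact sub_pos.2 ((mul_le_of_le_one_left h0' hP).trans_lt (h1'.trans_lt hya))

/-- **Semialgebraicity of the band integrand.**
`z ↦ c · (∏ spectatorsᵉ) · z_w^{a−b−1} z_{w+1}^b / (1 − (∏ spectators) · z_{w+1})` is a
`ℚ`-semialgebraic function on `T` (a quotient of `ℚ`-polynomials with non-vanishing denominator).
[Kontsevich–Zagier 2001, §1.1] [folklore] -/
theorem isSemialgebraicFunOn_bandIntegrandDim {w : ℕ} (e : Fin w → ℕ) (a b : ℕ) (c : ℚ) :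
    IsSemialgebraicFunOn ℚ
      (KZlog.band {y : Fin (w + 1) → ℝ | ∀ i, y i ∈ Set.Ioo (0:ℝ) 1} (fun _ => (0:ℝ))
        (fun y => y (Fin.last w)))
      (fun z => (c : ℝ) * ((∏ i, Fin.init (Fin.init z) i ^ e i) *
        (z (Fin.castSucc (Fin.last w)) ^ (a - b - 1) * z (Fin.last (w + 1)) ^ b)) /
        (1 - (∏ i, Fin.init (Fin.init z) i) * z (Fin.last (w + 1)))) := by
  refine (isSemialgebraicFunOn_aeval_div_aeval (isSemialgebraic_bandDim w)
    (MvPolynomial.C c * ((∏ i : Fin w, MvPolynomial.X (Fin.castSucc (Fin.castSucc i)) ^ e i) *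
      (MvPolynomial.X (Fin.castSucc (Fin.last w)) ^ (a - b - 1) *
        MvPolynomial.X (Fin.last (w + 1)) ^ b)))
    (1 - (∏ i : Fin w, MvPolynomial.X (Fin.castSucc (Fin.castSucc i))) *
      MvPolynomial.X (Fin.last (w + 1))) fun z hz => ?_).congr fun z _ => ?_
  · simp only [map_sub, map_one, map_mul, map_prod, MvPolynomial.aeval_X]
    exact (one_sub_prod_mul_pos_of_mem_bandDim hz).ne'
  · simp only [map_mul, map_prod, map_pow, map_sub, map_one, MvPolynomial.aeval_X,
      MvPolynomial.aeval_C, eq_ratCast]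
    rfl

/-! ## Absolute convergence on the band -/

/-- **The kernel `1/(1 − x₀⋯x_{w+1})` is integrable on the band-box** `B₀ = (0,1)^{w+1} × [0,1]`:
the `ζ(w+2)` box integral on the open box (`BoxIntegral.integrableOn_box_one_div_one_sub_prod`)
plus two null faces. [folklore] -/
theorem integrableOn_kernel_bandBoxDim (w : ℕ) :
    IntegrableOn (fun x : Fin (w + 2) → ℝ => 1 / (1 - ∏ i, x i))
      (KZlog.band {y : Fin (w + 1) → ℝ | ∀ i, y i ∈ Set.Ioo (0:ℝ) 1} (fun _ => (0:ℝ))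
        (fun _ => (1:ℝ))) := by
  have hsub : KZlog.band {y : Fin (w + 1) → ℝ | ∀ i, y i ∈ Set.Ioo (0:ℝ) 1} (fun _ => (0:ℝ))
        (fun _ => (1:ℝ)) ⊆
      {x : Fin (w + 2) → ℝ | ∀ i, x i ∈ Set.Ioo (0:ℝ) 1} ∪
        ({x | x (Fin.last (w + 1)) = 0} ∪ {x | x (Fin.last (w + 1)) = 1}) := by
    rintro x ⟨hxG, hx0, hx1⟩
    rcases eq_or_ne (x (Fin.last (w + 1))) 0 with h0 | h0
    · exact Or.inr (Or.inl h0)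
    rcases eq_or_ne (x (Fin.last (w + 1))) 1 with h1 | h1
    · exact Or.inr (Or.inr h1)
    refine Or.inl fun i => Fin.lastCases ?_ (fun j => hxG j) i
    exact ⟨lt_of_le_of_ne hx0 h0.symm, lt_of_le_of_ne hx1 h1⟩
  have hnull : volume ({x : Fin (w + 2) → ℝ | x (Fin.last (w + 1)) = 0} ∪
      {x | x (Fin.last (w + 1)) = 1}) = 0 :=
    measure_union_null
      (Measure.pi_hyperplane (fun _ : Fin (w + 2) => (volume : Measure ℝ)) (Fin.last (w + 1)) 0)
      (Measure.pi_hyperplane (fun _ : Fin (w + 2) => (volume : Measure ℝ)) (Fin.last (w + 1)) 1)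
  exact ((BoxIntegral.integrableOn_box_one_div_one_sub_prod (by omega : 2 ≤ w + 2)).union
    (IntegrableOn.of_measure_zero hnull)).mono_set hsub

/-- **Absolute convergence of the band integrand.**
`c · (∏ spectatorsᵉ) · z_w^{a−b−1} z_{w+1}^b / (1 − (∏ spectators) · z_{w+1})` is integrable on
`T`: change of variables `Φ x = (init x, x_w · x_{w+1})` from the band-box `B₀` (Jacobian `x_w`),
where the pulled-back integrand `c · (∏ spectatorsᵉ) · x_w^{a−b} (x_w x_{w+1})^b/(1 − x₀⋯x_{w+1})`
is dominated by `|c|/(1 − x₀⋯x_{w+1})`. [Kontsevich–Zagier 2001, §1.2 rule (2)] [folklore] -/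
theorem integrableOn_bandIntegrandDim {w : ℕ} (e : Fin w → ℕ) (a b : ℕ) (c : ℚ) :
    IntegrableOn (fun z : Fin (w + 2) → ℝ => (c : ℝ) * ((∏ i, Fin.init (Fin.init z) i ^ e i) *
        (z (Fin.castSucc (Fin.last w)) ^ (a - b - 1) * z (Fin.last (w + 1)) ^ b)) /
        (1 - (∏ i, Fin.init (Fin.init z) i) * z (Fin.last (w + 1))))
      (KZlog.band {y : Fin (w + 1) → ℝ | ∀ i, y i ∈ Set.Ioo (0:ℝ) 1} (fun _ => (0:ℝ))
        (fun y => y (Fin.last w))) := by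
  have hG : IsSemialgebraic ℚ {y : Fin (w + 1) → ℝ | ∀ i, y i ∈ Set.Ioo (0:ℝ) 1} :=
    isSemialgebraic_box (w + 1)
  -- the band-box `S = (0,1)^{w+1} × [0,1]`
  set S : Set (Fin (w + 2) → ℝ) :=
    KZlog.band {y : Fin (w + 1) → ℝ | ∀ i, y i ∈ Set.Ioo (0:ℝ) 1} (fun _ => (0:ℝ))
      (fun _ => (1:ℝ)) with hS
  have hSm : MeasurableSet S :=
    Literature.ModelTheory.ExponentialFields.IsSemialgebraic.measurableSet_holds
      (KZlog.isSemialgebraic_band (by simpa using isSemialgebraicFunOn_ratCast hG 0)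
        (by simpa using isSemialgebraicFunOn_ratCast hG 1))
  -- the merge chart and its derivative
  set Φ : (Fin (w + 2) → ℝ) → (Fin (w + 2) → ℝ) := fun x =>
    Fin.snoc (Fin.init x) (x (Fin.castSucc (Fin.last w)) * x (Fin.last (w + 1))) with hΦ
  let pA : (Fin (w + 2) → ℝ) →L[ℝ] ℝ := ContinuousLinearMap.proj (Fin.castSucc (Fin.last w))
  let pL : (Fin (w + 2) → ℝ) →L[ℝ] ℝ := ContinuousLinearMap.proj (Fin.last (w + 1))
  let row : (Fin (w + 2) → ℝ) → (Fin (w + 2) → ℝ) →L[ℝ] ℝ := fun x =>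
    x (Fin.last (w + 1)) • pA + x (Fin.castSucc (Fin.last w)) • pL
  have hrow : ∀ x v, row x v = x (Fin.last (w + 1)) * v (Fin.castSucc (Fin.last w)) +
      x (Fin.castSucc (Fin.last w)) * v (Fin.last (w + 1)) := by
    intro x v
    simp [row, pA, pL]
  let Φ' : (Fin (w + 2) → ℝ) → (Fin (w + 2) → ℝ) →L[ℝ] (Fin (w + 2) → ℝ) := fun x =>
    ContinuousLinearMap.pi
      (Fin.lastCases (motive := fun _ => (Fin (w + 2) → ℝ) →L[ℝ] ℝ) (row x)
        (fun i => ContinuousLinearMap.proj (Fin.castSucc i)))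
  have hΦ' : ∀ x v, Φ' x v = Fin.snoc (Fin.init v) (row x v) := by
    intro x v
    funext i
    refine Fin.lastCases ?_ (fun j => ?_) i
    · simp [Φ']
    · simp [Φ', Fin.init]
  have hdet : ∀ x, (Φ' x).det = x (Fin.castSucc (Fin.last w)) := by
    intro x
    have h := LinearMap.det_of_snoc_init
      (Φ' x : (Fin (w + 1 + 1) → ℝ) →ₗ[ℝ] (Fin (w + 1 + 1) → ℝ)) LinearMap.id
      ((x (Fin.last (w + 1)) •
        LinearMap.proj (R := ℝ) (φ := fun _ : Fin (w + 1) => ℝ) (Fin.last w)))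
      (x (Fin.castSucc (Fin.last w))) (fun v => by
        rw [ContinuousLinearMap.coe_coe, hΦ', hrow]
        simp [Fin.init])
    rw [LinearMap.det_id, mul_one] at h
    exact h
  have hderiv : ∀ x, HasFDerivAt Φ (Φ' x) x := by
    intro x
    rw [hasFDerivAt_pi']
    intro i
    refine Fin.lastCases ?_ (fun j => ?_) i
    · have hA : HasFDerivAt (fun y : Fin (w + 2) → ℝ => y (Fin.castSucc (Fin.last w))) pA x :=
        hasFDerivAt_apply _ x
      have hL : HasFDerivAt (fun y : Fin (w + 2) → ℝ => y (Fin.last (w + 1))) pL x :=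
        hasFDerivAt_apply _ x
      have hfun : (fun y => Φ y (Fin.last (w + 1))) =
          fun y => y (Fin.castSucc (Fin.last w)) * y (Fin.last (w + 1)) := by
        funext y
        simp [hΦ]
      show HasFDerivAt (fun y => Φ y (Fin.last (w + 1))) _ x
      rw [hfun]
      refine (hA.mul hL).congr_fderiv (ContinuousLinearMap.ext fun v => ?_)
      rw [ContinuousLinearMap.coe_comp, Function.comp_apply, hΦ']
      simp only [ContinuousLinearMap.proj_apply, Fin.snoc_last, hrow]
      simp [pA, pL]
      ring
    · have hfun : (fun y => Φ y (Fin.castSucc j)) = fun y => y (Fin.castSucc j) := by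
        funext y
        simp [hΦ, Fin.init]
      show HasFDerivAt (fun y => Φ y (Fin.castSucc j)) _ x
      rw [hfun]
      refine (hasFDerivAt_apply (Fin.castSucc j) x).congr_fderiv
        (ContinuousLinearMap.ext fun v => ?_)
      rw [ContinuousLinearMap.coe_comp, Function.comp_apply, hΦ']
      simp [Fin.init]
  have hinj : InjOn Φ S := by
    intro x₁ _ x₂ hx₂ h
    have hy : Fin.init x₁ = Fin.init x₂ := by
      have := congrArg Fin.init h
      simpa [hΦ] using this
    have hl : x₁ (Fin.castSucc (Fin.last w)) * x₁ (Fin.last (w + 1)) =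
        x₂ (Fin.castSucc (Fin.last w)) * x₂ (Fin.last (w + 1)) := by
      have := congrFun h (Fin.last (w + 1))
      simpa [hΦ] using this
    have ha : x₁ (Fin.castSucc (Fin.last w)) = x₂ (Fin.castSucc (Fin.last w)) :=
      congrFun hy (Fin.last w)
    rw [ha] at hl
    have hpos : 0 < x₂ (Fin.castSucc (Fin.last w)) := (hx₂.1 (Fin.last w)).1
    have hs : x₁ (Fin.last (w + 1)) = x₂ (Fin.last (w + 1)) := mul_left_cancel₀ hpos.ne' hl
    rw [← Fin.snoc_init_self x₁, ← Fin.snoc_init_self x₂, hy, hs]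
  have key := integrableOn_image_iff_integrableOn_abs_det_fderiv_smul volume hSm
    (fun x _ => (hderiv x).hasFDerivWithinAt) hinj
    (fun z : Fin (w + 2) → ℝ => (c : ℝ) * ((∏ i, Fin.init (Fin.init z) i ^ e i) *
        (z (Fin.castSucc (Fin.last w)) ^ (a - b - 1) * z (Fin.last (w + 1)) ^ b)) /
        (1 - (∏ i, Fin.init (Fin.init z) i) * z (Fin.last (w + 1))))
  -- the band is contained in the image of the band-box
  have hTsub : KZlog.band {y : Fin (w + 1) → ℝ | ∀ i, y i ∈ Set.Ioo (0:ℝ) 1} (fun _ => (0:ℝ))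
      (fun y => y (Fin.last w)) ⊆ Φ '' S := by
    rintro z ⟨hzG, hz0, hz1⟩
    have hya : 0 < z (Fin.castSucc (Fin.last w)) := (hzG (Fin.last w)).1
    have hz0' : 0 ≤ z (Fin.last (w + 1)) := hz0
    have hz1' : z (Fin.last (w + 1)) ≤ z (Fin.castSucc (Fin.last w)) := hz1
    refine ⟨Fin.snoc (Fin.init z) (z (Fin.last (w + 1)) / z (Fin.castSucc (Fin.last w))),
      KZlog.snoc_mem_band.2 ⟨hzG, div_nonneg hz0' hya.le, (div_le_one hya).2 hz1'⟩, ?_⟩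
    simp only [hΦ, Fin.init_snoc, Fin.snoc_last, Fin.snoc_castSucc]
    rw [show Fin.init z (Fin.last w) = z (Fin.castSucc (Fin.last w)) from rfl,
      mul_div_cancel₀ _ hya.ne', Fin.snoc_init_self]
  -- the pulled-back integrand is dominated by `|c|/(1 − x₀⋯x_{w+1})`
  have hF : IntegrableOn (fun x : Fin (w + 2) → ℝ => x (Fin.castSucc (Fin.last w)) *
      ((c : ℝ) * ((∏ i, x (Fin.castSucc (Fin.castSucc i)) ^ e i) *
        (x (Fin.castSucc (Fin.last w)) ^ (a - b - 1) *
          (x (Fin.castSucc (Fin.last w)) * x (Fin.last (w + 1))) ^ b)) /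
        (1 - (∏ i, x (Fin.castSucc (Fin.castSucc i))) *
          (x (Fin.castSucc (Fin.last w)) * x (Fin.last (w + 1)))))) S := by
    refine Integrable.mono' ((integrableOn_kernel_bandBoxDim w).const_mul |(c:ℝ)|) ?_
      (ae_restrict_of_forall_mem hSm fun x hx => ?_)
    · exact (Measurable.aestronglyMeasurable (by fun_prop))
    · have hya : 0 < x (Fin.castSucc (Fin.last w)) ∧ x (Fin.castSucc (Fin.last w)) < 1 :=
        hx.1 (Fin.last w)
      have hsp : ∀ i : Fin w, 0 < x (Fin.castSucc (Fin.castSucc i)) ∧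
          x (Fin.castSucc (Fin.castSucc i)) < 1 := fun i => hx.1 (Fin.castSucc i)
      have hx0 : 0 ≤ x (Fin.last (w + 1)) := hx.2.1
      have hx1 : x (Fin.last (w + 1)) ≤ 1 := hx.2.2
      have hP1 : ∏ i, x (Fin.castSucc (Fin.castSucc i)) ≤ 1 :=
        Finset.prod_le_one (fun i _ => (hsp i).1.le) fun i _ => (hsp i).2.le
      have hm0 : 0 ≤ x (Fin.castSucc (Fin.last w)) * x (Fin.last (w + 1)) :=
        mul_nonneg hya.1.le hx0
      have hm1 : x (Fin.castSucc (Fin.last w)) * x (Fin.last (w + 1)) < 1 :=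
        (mul_le_of_le_one_right hya.1.le hx1).trans_lt hya.2
      have hD : 0 < 1 - (∏ i, x (Fin.castSucc (Fin.castSucc i))) *
          (x (Fin.castSucc (Fin.last w)) * x (Fin.last (w + 1))) :=
        sub_pos.2 ((mul_le_of_le_one_left hm0 hP1).trans_lt hm1)
      have hN0 : 0 ≤ (∏ i, x (Fin.castSucc (Fin.castSucc i)) ^ e i) *
          (x (Fin.castSucc (Fin.last w)) ^ (a - b - 1) *
            (x (Fin.castSucc (Fin.last w)) * x (Fin.last (w + 1))) ^ b) :=
        mul_nonneg (Finset.prod_nonneg fun i _ => pow_nonneg (hsp i).1.le _)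
          (mul_nonneg (pow_nonneg hya.1.le _) (pow_nonneg hm0 _))
      have hN1 : (∏ i, x (Fin.castSucc (Fin.castSucc i)) ^ e i) *
          (x (Fin.castSucc (Fin.last w)) ^ (a - b - 1) *
            (x (Fin.castSucc (Fin.last w)) * x (Fin.last (w + 1))) ^ b) ≤ 1 :=
        mul_le_one₀ (Finset.prod_le_one (fun i _ => pow_nonneg (hsp i).1.le _)
            fun i _ => pow_le_one₀ (hsp i).1.le (hsp i).2.le)
          (mul_nonneg (pow_nonneg hya.1.le _) (pow_nonneg hm0 _))
          (mul_le_one₀ (pow_le_one₀ hya.1.le hya.2.le) (pow_nonneg hm0 _)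
            (pow_le_one₀ hm0 hm1.le))
      have hprod : ∏ i, x i = (∏ i, x (Fin.castSucc (Fin.castSucc i))) *
          (x (Fin.castSucc (Fin.last w)) * x (Fin.last (w + 1))) := by
        rw [Fin.prod_univ_castSucc, Fin.prod_univ_castSucc, mul_assoc]
      calc ‖x (Fin.castSucc (Fin.last w)) *
            ((c : ℝ) * ((∏ i, x (Fin.castSucc (Fin.castSucc i)) ^ e i) *
              (x (Fin.castSucc (Fin.last w)) ^ (a - b - 1) *
                (x (Fin.castSucc (Fin.last w)) * x (Fin.last (w + 1))) ^ b)) /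
            (1 - (∏ i, x (Fin.castSucc (Fin.castSucc i))) *
              (x (Fin.castSucc (Fin.last w)) * x (Fin.last (w + 1)))))‖
          = x (Fin.castSucc (Fin.last w)) *
              ((∏ i, x (Fin.castSucc (Fin.castSucc i)) ^ e i) *
                (x (Fin.castSucc (Fin.last w)) ^ (a - b - 1) *
                  (x (Fin.castSucc (Fin.last w)) * x (Fin.last (w + 1))) ^ b)) *
              (|(c:ℝ)| / (1 - (∏ i, x (Fin.castSucc (Fin.castSucc i))) *
                (x (Fin.castSucc (Fin.last w)) * x (Fin.last (w + 1))))) := by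
            rw [Real.norm_eq_abs, abs_mul, abs_div, abs_mul, abs_of_pos hya.1, abs_of_pos hD,
              abs_of_nonneg hN0]
            ring
        _ ≤ |(c:ℝ)| / (1 - (∏ i, x (Fin.castSucc (Fin.castSucc i))) *
              (x (Fin.castSucc (Fin.last w)) * x (Fin.last (w + 1)))) :=
            mul_le_of_le_one_left (div_nonneg (abs_nonneg _) hD.le) (mul_le_one₀ hya.2.le hN0 hN1)
        _ = |(c:ℝ)| * (1 / (1 - ∏ i, x i)) := by rw [hprod, mul_one_div]
  refine (key.2 (hF.congr_fun (fun x hx => ?_) hSm)).mono_set hTsub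
  have hya : 0 < x (Fin.castSucc (Fin.last w)) := (hx.1 (Fin.last w)).1
  rw [hdet, abs_of_pos hya, smul_eq_mul]
  simp only [hΦ, Fin.init_snoc, Fin.snoc_castSucc, Fin.snoc_last]
  rfl

/-- **T4 (existence of the band representation after the merge gadget, dimension `w + 2`).** For
`a > b`, `c ∈ ℚ` and spectator exponents `e : Fin w → ℕ` there is an integral representation of
dimension `w + 2` with domain the band `T = {z | init z ∈ (0,1)^{w+1}, 0 ≤ z_{w+1} ≤ z_w}` and
integrand `z ↦ c · (∏ spectatorsᵉ) · z_w^{a−b−1} z_{w+1}^b / (1 − (∏ spectators) · z_{w+1})` — the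
image of the box monomial `c · (∏ spectatorsᵉ) · z_w^a z_{w+1}^b/(1 − z₀⋯z_{w+1})` under the merge
gadget `z_{w+1} ↦ z_w · z_{w+1}`. [Kontsevich–Zagier 2001, §1.1–1.2] [folklore] -/
theorem exists_bandRep_dim {w : ℕ} (e : Fin w → ℕ) (a b : ℕ) (c : ℚ) (hab : b < a) :
    ∃ R : IntegralRep (w + 2),
      R.domain = KZlog.band {y : Fin (w + 1) → ℝ | ∀ i, y i ∈ Set.Ioo (0:ℝ) 1} (fun _ => (0:ℝ))
        (fun y => y (Fin.last w)) ∧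
      R.integrand = fun z => (c : ℝ) * ((∏ i, Fin.init (Fin.init z) i ^ e i) *
        (z (Fin.castSucc (Fin.last w)) ^ (a - b - 1) * z (Fin.last (w + 1)) ^ b)) /
        (1 - (∏ i, Fin.init (Fin.init z) i) * z (Fin.last (w + 1))) := by
  have _ := hab -- existence does not need `b < a` (for `b ≥ a` the exponent `a - b - 1` is `0`)
  exact ⟨⟨_, _, isSemialgebraic_bandDim w, isSemialgebraicFunOn_bandIntegrandDim e a b c,
    integrableOn_bandIntegrandDim e a b c⟩, rfl, rfl⟩

end Summit.KontsevichZagierPeriods.HurwitzMicroSectors.NormalFormPrinciple.PiBox.LevelOne
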